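import Literature.NumberTheory.K2Lit.SiegelDoubledUnipotent
import Summits.HodgeConjecture.HodgeConjecture.Theorems.K2LiuSiegelDoubledRationalMultiplicity
import Summits.HodgeConjecture.HodgeConjecture.Theorems.K2LiuSiegelDoubledUnfold
import Literature.MeasureTheory.Group.CoveringWeights
import Mathlib.MeasureTheory.Measure.Haar.Basic
import HarnessLib

/-!
# Compactly supported covering weights for `N_Δ(L⁺)` on `N_Δ(𝔸)` (O41.3, file (iii-a))

Track B ∕ hLiu418 = stmt-HodgeConjecture-24832, line `K2_Liu_CurveThetaSigs`, unit U6 «FIRST TERM», socket #41, organ O41.3 «convergence of the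
Siegel intertwining operator `M(s)f(h) = ∫_{N_Δ(𝔸)} f(w_Δ u h) du`» (LEAD F0P6-plan deal 2026-09-03T23:05:23Z to seat `hodgecm-mathlib-K2Liu-p06` (g0);
steward K2Liu-p01 lineage), FILE (iii-a); shared with organ O41.4 (K2Liu-p07 (g2), «ORBIT FORM» binder `β`).

The printed convergence proof [MoeglinWaldspurger1995, II.1.6 Prop. (i)] integrates the Eisenstein majorant over the COMPACT quotient
`U'(k)\U'(𝔸)`. In the tree's quotient-free currency (★ `Literature.MeasureTheory.Group.CoveringWeights`) «compact quotient» is consumed as a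
COVERING WEIGHT WITH COMPACT SUPPORT: a measurable `β ≥ 0` on `N_Δ(𝔸)` with `Σ_{γ ∈ N_Δ(L⁺)} β(γ u) = 1` and `β ≤ 1_K` for a compact `K`. This
file builds it from a compact set `K` meeting every `N_Δ(L⁺)`-orbit:

* §1 (generic, any countable group `Γ` acting measurably on `X`) `exists_isCoveringWeight_of_cover` — if a measurable `K` meets every orbit and
  every orbit meets `K` finitely often, then `β := 1_K ∕ #{γ : γ • x ∈ K}` is a covering weight with `β ≤ 1_K`;
* §2 (instantiation, ★ D9 `unipDelta ∕ unipDeltaRat`) `exists_isCoveringWeight_unipDeltaRat_of_cover` — for a COMPACT `K ⊆ N_Δ(𝔸)` with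
  `N_Δ(L⁺) · K = N_Δ(𝔸)` there is an `N_Δ(L⁺)`-covering weight `β ≤ 1_K` (the orbit-finiteness comes from the discreteness of `H(L⁺)` in `H(𝔸)`,
  ★ `K2LiuSiegelDoubledRationalMultiplicity.finite_ratH_inter`), and `∫⁻ β dνN ≤ νN(K) < ∞` for every Haar measure `νN` on `N_Δ(𝔸)`.
  The cover hypothesis (C0) — cocompactness of `N_Δ(L⁺)` in `N_Δ(𝔸) ≅ Herm_n(𝔸_{L⁺})` — is organ E5′c's first half (K2Liu-p09 crew) and is
  taken as a binder here.

Theorems only (no definition, no instance); axioms ⊆ {propext, Classical.choice, Quot.sound}.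

## References
* C. Moeglin, J.-L. Waldspurger, *Spectral decomposition and Eisenstein series* (1995), II.1.6 (proof of Prop. (i): «as `U'(k)\U'(𝔸)` is compact
  … this term is finite») [MoeglinWaldspurger1995].
* A. Borel, *Some finiteness properties of adele groups over number fields*, Publ. IHÉS 16 (1963), §1.2 (discreteness of `G(k)` in `G(𝔸)`) [Borel1963].

HONEST LABEL: HC_CM is proved only modulo the 7 printed citations (2 remaining named inputs: hLiu418 = stmt-HodgeConjecture-24832,
h413 = stmt-HodgeConjecture-24833) until rung 0 closes; this helper moves no counter.
-/

noncomputable section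

set_option autoImplicit false

set_option linter.dupNamespace false

open MeasureTheory Function Set
open scoped ENNReal Matrix
open Literature.MeasureTheory.Group

namespace Summit.HodgeConjecture.HodgeConjecture.Cruxes.HLiu418.K2LiuUnipotentCoveringWeight

/-! ## §1 Generic: a covering weight from a set meeting every orbit finitely often -/

section Generic

variable {Γ : Type*} [Group Γ] [Countable Γ] {X : Type*} [MulAction Γ X] [MeasurableSpace X] [MeasurableConstSMul Γ X]

omit [Countable Γ] [MeasurableSpace X] [MeasurableConstSMul Γ X] in
/-- The orbit multiplicity `#{γ : γ • x ∈ K}`, as the covering sum of `1_K`, is finite when the orbit meets `K` finitely often. [folklore] -/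
theorem coveringSum_indicator_ne_top {K : Set X} (x : X) (hfin : {γ : Γ | γ • x ∈ K}.Finite) :
    coveringSum Γ (K.indicator (1 : X → ℝ≥0∞)) x ≠ ∞ := by
  classical
  rw [coveringSum_apply, tsum_eq_sum (s := hfin.toFinset) (fun γ hγ => ?_)]
  · refine ENNReal.sum_ne_top.2 fun γ _ => ?_
    exact ne_top_of_le_ne_top ENNReal.one_ne_top (Set.indicator_apply_le' (fun _ => le_rfl) (fun _ => zero_le_one))
  · rw [Set.Finite.mem_toFinset, Set.mem_setOf_eq] at hγ
    exact Set.indicator_of_notMem hγ _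

omit [Countable Γ] [MeasurableSpace X] [MeasurableConstSMul Γ X] in
/-- The orbit multiplicity is `≥ 1` (hence non-zero) when the orbit meets `K`. [folklore] -/
theorem one_le_coveringSum_indicator {K : Set X} (x : X) (hcover : ∃ γ : Γ, γ • x ∈ K) :
    1 ≤ coveringSum Γ (K.indicator (1 : X → ℝ≥0∞)) x := by
  obtain ⟨γ, hγ⟩ := hcover
  rw [coveringSum_apply]
  calc (1 : ℝ≥0∞) = K.indicator (1 : X → ℝ≥0∞) (γ • x) := by rw [Set.indicator_of_mem hγ, Pi.one_apply]
    _ ≤ ∑' γ' : Γ, K.indicator (1 : X → ℝ≥0∞) (γ' • x) := ENNReal.le_tsum γ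

/-- **A covering weight from a set meeting every orbit finitely often.** Let a countable group `Γ` act measurably on `X` and let `K ⊆ X` be
measurable, meeting every orbit (`∀ x, ∃ γ, γ • x ∈ K`) and each orbit only finitely often (`{γ : γ • x ∈ K}` finite). Then
`β(x) := 1_K(x) ∕ #{γ : γ • x ∈ K}` is a covering weight (`Σ_γ β(γ • x) = 1`: the multiplicity is constant along orbits) supported in `K`, with
`β ≤ 1_K`. This is the «smooth fundamental domain» attached to a compact set covering a compact quotient. [folklore]
[cite: MoeglinWaldspurger1995, II.1.6 (proof of Prop. (i))] -/
theorem exists_isCoveringWeight_of_cover {K : Set X} (hKm : MeasurableSet K)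
    (hfin : ∀ x : X, {γ : Γ | γ • x ∈ K}.Finite) (hcover : ∀ x : X, ∃ γ : Γ, γ • x ∈ K) :
    ∃ β : X → ℝ≥0∞, IsCoveringWeight Γ β ∧ (∀ x, β x ≠ 0 → x ∈ K) ∧ ∀ x, β x ≤ K.indicator 1 x := by
  set m : X → ℝ≥0∞ := coveringSum Γ (K.indicator (1 : X → ℝ≥0∞)) with hmdef
  have hm0 : ∀ x, m x ≠ 0 := fun x => (lt_of_lt_of_le one_pos (one_le_coveringSum_indicator x (hcover x))).ne'
  have hmtop : ∀ x, m x ≠ ∞ := fun x => coveringSum_indicator_ne_top x (hfin x)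
  have hminv : ∀ (γ : Γ) (x : X), m (γ • x) = m x := fun γ x => coveringSum_smul _ γ x
  have hind : Measurable (K.indicator (1 : X → ℝ≥0∞)) := measurable_one.indicator hKm
  have hmm : Measurable m := measurable_coveringSum hind
  refine ⟨fun x => K.indicator (1 : X → ℝ≥0∞) x * (m x)⁻¹, ⟨hind.mul hmm.inv, fun x => ?_⟩, fun x hx => ?_, fun x => ?_⟩
  · -- covering sum `= (Σ_γ 1_K(γ x)) · (m x)⁻¹ = 1`
    rw [coveringSum_apply]
    simp_rw [hminv]
    rw [ENNReal.tsum_mul_right, ← coveringSum_apply, ENNReal.mul_inv_cancel (hm0 x) (hmtop x)]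
  · by_contra hxK
    exact hx (show K.indicator (1 : X → ℝ≥0∞) x * (m x)⁻¹ = 0 by rw [Set.indicator_of_notMem hxK, zero_mul])
  · calc K.indicator (1 : X → ℝ≥0∞) x * (m x)⁻¹ ≤ K.indicator (1 : X → ℝ≥0∞) x * 1 :=
          mul_le_mul' le_rfl (ENNReal.inv_le_one.2 (one_le_coveringSum_indicator x (hcover x)))
      _ = K.indicator 1 x := mul_one _

/-- The integral of such a weight is at most the measure of `K`. [folklore] -/
theorem lintegral_le_measure_of_le_indicator (μ : Measure X) {K : Set X} (hKm : MeasurableSet K) {β : X → ℝ≥0∞}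
    (hβ : ∀ x, β x ≤ K.indicator 1 x) : ∫⁻ x, β x ∂μ ≤ μ K := by
  calc ∫⁻ x, β x ∂μ ≤ ∫⁻ x, K.indicator 1 x ∂μ := lintegral_mono hβ
    _ = μ K := by rw [lintegral_indicator_one hKm]

end Generic

/-! ## §2 The unipotent radical `N_Δ(𝔸)` of the doubled Siegel parabolic -/

section Unipotent

open NumberField IsDedekindDomain
open Literature.NumberTheory.Automorphic Literature.NumberTheory.GaloisRepresentations
open Literature.NumberTheory.GelbartRogawski1991 Literature.NumberTheory.GelbartRogawski1991.GRConstruction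
open Literature.NumberTheory.K2Lit.SiegelDoubled
open Summit.HodgeConjecture.HodgeConjecture.Cruxes.HLiu418.K2LiuSiegelDoubledRationalMultiplicity
open Summit.HodgeConjecture.HodgeConjecture.Cruxes.HLiu418.K2LiuSiegelDoubledUnfold

variable (L : Type) [Field L] [NumberField L] [IsCMField L]
variable {N M n : ℕ} (e : Fin N × Fin M ≃ Fin n)
  (dV : Fin N → L) (hdV : ∀ i, IsCMField.complexConj L (dV i) = dV i)
  (dW : Fin M → L) (hdW : ∀ i, IsCMField.complexConj L (dW i) = dW i)

/-- `N_Δ(L⁺)` is countable (it embeds in the countable `H(L⁺)`, ★ `countable_ratH`). [cite: Borel1963, §1.2] -/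
theorem countable_unipDeltaRat : Countable (unipDeltaRat L e dV hdV dW hdW) := by
  haveI : Countable (ratH L e dV hdV dW hdW) := countable_ratH L e dV hdV dW hdW
  have hinj : Function.Injective (fun γ : unipDeltaRat L e dV hdV dW hdW =>
      (⟨((γ : unipDelta L e dV hdV dW hdW) : HA L e dV hdV dW hdW), (mem_unipDeltaRat_iff L e dV hdV dW hdW γ).1 γ.2⟩ :
        ratH L e dV hdV dW hdW)) := by
    intro γ γ' h
    have h' := congrArg (fun r : ratH L e dV hdV dW hdW => (r : HA L e dV hdV dW hdW)) h
    exact Subtype.ext (Subtype.ext h')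
  exact hinj.countable

/-- **Orbit finiteness**: for a compact `K ⊆ N_Δ(𝔸)` and `u ∈ N_Δ(𝔸)`, only finitely many `γ ∈ N_Δ(L⁺)` have `γ u ∈ K` — they lie in the
finite set `H(L⁺) ∩ K u⁻¹` (★ `finite_ratH_inter`: `H(L⁺)` is discrete in `H(𝔸)`). [cite: Borel1963, §1.2] -/
theorem finite_unipDeltaRat_smul_mem {K : Set (unipDelta L e dV hdV dW hdW)} (hK : IsCompact K)
    (u : unipDelta L e dV hdV dW hdW) :
    {γ : unipDeltaRat L e dV hdV dW hdW | γ • u ∈ K}.Finite := by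
  -- the compact set `K u⁻¹ ⊆ H(𝔸)`
  set C : Set (HA L e dV hdV dW hdW) :=
    (fun k : unipDelta L e dV hdV dW hdW => (k : HA L e dV hdV dW hdW) * ((u : HA L e dV hdV dW hdW))⁻¹) '' K with hCdef
  have hC : IsCompact C := hK.image (continuous_subtype_val.mul continuous_const)
  have hfin := finite_ratH_inter L e dV hdV dW hdW hC
  -- `γ ↦ (γ : H(𝔸))` is injective and maps our set into `H(L⁺) ∩ C`
  let ι : unipDeltaRat L e dV hdV dW hdW → HA L e dV hdV dW hdW := fun γ => ((γ : unipDelta L e dV hdV dW hdW) : HA L e dV hdV dW hdW)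
  have hι : Function.Injective ι := fun γ γ' h => Subtype.ext (Subtype.ext h)
  refine (hfin.preimage hι.injOn).subset fun γ hγ => ?_
  rw [Set.mem_setOf_eq] at hγ
  refine ⟨(mem_unipDeltaRat_iff L e dV hdV dW hdW γ).1 γ.2, ⟨γ • u, hγ, ?_⟩⟩
  change (((γ : unipDelta L e dV hdV dW hdW) * u : unipDelta L e dV hdV dW hdW) : HA L e dV hdV dW hdW) *
      ((u : HA L e dV hdV dW hdW))⁻¹ = ι γ
  rw [Subgroup.coe_mul, mul_inv_cancel_right]

/-- **Compactly supported covering weights for `N_Δ(L⁺)` on `N_Δ(𝔸)`.** If a compact `K ⊆ N_Δ(𝔸)` meets every left `N_Δ(L⁺)`-orbit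
(hypothesis (C0): `N_Δ(L⁺) · K = N_Δ(𝔸)`, i.e. `N_Δ(L⁺)\N_Δ(𝔸)` is compact — organ E5′c), then there is an `N_Δ(L⁺)`-covering weight `β` on
`N_Δ(𝔸)` supported in `K` with `β ≤ 1_K`. This is the object the intertwining-operator convergence (O41.3) and the constant-term unfolding
(O41.4) integrate the Eisenstein majorant against. [cite: MoeglinWaldspurger1995, II.1.6 (proof of Prop. (i))] [cite: Borel1963, §1.2] -/
theorem exists_isCoveringWeight_unipDeltaRat_of_cover [MeasurableSpace (unipDelta L e dV hdV dW hdW)]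
    [BorelSpace (unipDelta L e dV hdV dW hdW)]
    {K : Set (unipDelta L e dV hdV dW hdW)} (hK : IsCompact K)
    (hcover : ∀ u : unipDelta L e dV hdV dW hdW, ∃ γ : unipDeltaRat L e dV hdV dW hdW, γ • u ∈ K) :
    ∃ β : unipDelta L e dV hdV dW hdW → ℝ≥0∞, IsCoveringWeight (unipDeltaRat L e dV hdV dW hdW) β ∧
      (∀ u, β u ≠ 0 → u ∈ K) ∧ ∀ u, β u ≤ K.indicator 1 u := by
  haveI : Countable (unipDeltaRat L e dV hdV dW hdW) := countable_unipDeltaRat L e dV hdV dW hdW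
  exact exists_isCoveringWeight_of_cover hK.isClosed.measurableSet
    (fun u => finite_unipDeltaRat_smul_mem L e dV hdV dW hdW hK u) hcover

/-- … and such a weight has finite integral against every Haar measure on `N_Δ(𝔸)`: `∫⁻ β dνN ≤ νN(K) < ∞`.
[cite: MoeglinWaldspurger1995, II.1.6 (proof of Prop. (i))] -/
theorem exists_isCoveringWeight_unipDeltaRat_lintegral_ne_top [MeasurableSpace (unipDelta L e dV hdV dW hdW)]
    [BorelSpace (unipDelta L e dV hdV dW hdW)] (νN : Measure (unipDelta L e dV hdV dW hdW)) [νN.IsHaarMeasure]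
    {K : Set (unipDelta L e dV hdV dW hdW)} (hK : IsCompact K)
    (hcover : ∀ u : unipDelta L e dV hdV dW hdW, ∃ γ : unipDeltaRat L e dV hdV dW hdW, γ • u ∈ K) :
    ∃ β : unipDelta L e dV hdV dW hdW → ℝ≥0∞, IsCoveringWeight (unipDeltaRat L e dV hdV dW hdW) β ∧
      (∀ u, β u ≠ 0 → u ∈ K) ∧ (∀ u, β u ≤ K.indicator 1 u) ∧ ∫⁻ u, β u ∂νN ≠ ∞ := by
  obtain ⟨β, hβ, hsupp, hle⟩ := exists_isCoveringWeight_unipDeltaRat_of_cover L e dV hdV dW hdW hK hcover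
  exact ⟨β, hβ, hsupp, hle, ne_top_of_le_ne_top hK.measure_lt_top.ne
    (lintegral_le_measure_of_le_indicator νN hK.isClosed.measurableSet hle)⟩

end Unipotent

end Summit.HodgeConjecture.HodgeConjecture.Cruxes.HLiu418.K2LiuUnipotentCoveringWeight

end
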